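import Summits.AnomalousDissipation.AnomalousDissipation.Theorems.MirrorStatisticsLoudTG.Negative.LoadBearing
import Summits.AnomalousDissipation.AnomalousDissipation.Theorems.MirrorEnsembleMirrorStatisticsLoudTGStubTubeLawSmoothKTools
import Summits.AnomalousDissipation.AnomalousDissipation.Theorems.MirrorEnsembleMirrorStatisticsLoudTGStubTubeLawSmoothKTools2
import HarnessLib

/-!
# Stub `stub_tubeLawSmoothK` of line `regimes`, crux `MirrorEnsemble.MirrorStatisticsLoudTG` (stmt-AnomalousDissipation-17693)

THE DETERMINISTIC KELVIN TUBE INEQUALITY (T2b). Let `C = ∂([0,½]² × {x₂ = 0}) ⊂ T³` be the edge loop of the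
impermeable box of the Taylor–Green vortex and `g = (η(x₂)ρ(x₀)ρ'(x₁), -η(x₂)ρ'(x₀)ρ(x₁), 0)` its smoothed tube
current (stub T1: `1`-periodic profiles, `|η| ≤ A/δ` supported in `‖x₂‖ ≤ δ`, `|ρ| ≤ 1`, `|ρ'| ≤ A/δ` supported
within `2δ` of the planes `x = 0, ½`, read in the fundamental-domain coordinates `Torus.repr x ∈ [0,1)³`). For
every smooth divergence-free mean-zero field `v` on `T³` exactly symmetric under the three mirrors
`R_i : xᵢ ↦ -xᵢ` (`v_j ∘ R_i = ∓ v_j`, the point symmetries of the TG class `Fix K`):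
`|∫ ⟪Dg(x)[v(x)], v(x)⟫ dx| ≤ K A³ δ⁻¹ ∫_{N_δ} ∑ⱼ ‖∂ⱼv‖² dx` with `K = 28`, `N_δ` the `δ`-neighbourhood of `C`
(`‖x₂‖ ≤ δ` and `x₀` or `x₁` within `2δ` of `{0, ½}`). The slab Poincaré inequality for smooth odd functions
(stub T2a `stub_oddPoincareK`) is the HYPOTHESIS of the registered signature; with the transfer stub T3 and the
landed mean Reynolds-stress balance this is the statistical Kelvin tube law of line `regimes`.

Proof (with the tools files `…StubTubeLawSmoothKTools`, `…StubTubeLawSmoothKTools2`): `∫ ⟪Dg[v], v⟫ =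
-∫ ⟪g, Dv[v]⟫ = -∑_{k∈{0,1}} ∑ⱼ ∫ gₖ vⱼ ∂ⱼvₖ` (`div v = 0`, `g₂ = 0`); transversal terms `j ≠ k`: Young's
inequality and the odd Poincaré inequality for `vⱼ` across `xⱼ ∈ {0, ½}` against the weight `|gₖ| ≤ A²δ⁻² 𝟙(slabs)`;
longitudinal terms `j = k`: one more integration by parts of `½ ∂ₖ(vₖ²)` (no boundary on `T³`) onto the corner
weight `|∂ₖgₖ| ≤ A³δ⁻³ 𝟙(corners)`, then the odd Poincaré inequality for `vₖ` (`tube_component_bound`).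

Sources: M. E. Brachet, D. I. Meiron, S. A. Orszag, B. G. Nickel, R. H. Morf, U. Frisch, *Small-scale structure
of the Taylor–Green vortex*, J. Fluid Mech. 130 (1983) 411–452, §2 (TG symmetries, the impermeable box `[0,½]³`)
[doi:10.1017/s0022112083001159]; weighted Hardy/Poincaré, Young and integration by parts on the torus are
folklore (L. C. Evans, *Partial Differential Equations*, 2nd ed., App. B.2, App. C.2).
-/

-- every `Summit.AnomalousDissipation.AnomalousDissipation.…` name repeats the summit = problem segment (tree layout)
set_option linter.dupNamespace false

noncomputable section

namespace Summit.AnomalousDissipation.AnomalousDissipation.Theorems.MirrorEnsembleMirrorStatisticsLoudTG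

open MeasureTheory Filter Topology
open scoped ENNReal InnerProductSpace NNReal
open Literature.Analysis.FunctionSpaces Literature.Analysis.FluidPDE
/-! ## The per-component bound -/

/-- **Per-component tube bound.** For the longitudinal index `k` and the other horizontal index `l`,
a smooth weight `w` with `|w| ≤ A²δ⁻² 𝟙_{‖x₂‖≤δ} (𝟙_{‖x_l‖≤2δ} + 𝟙_{‖x_l-½‖≤2δ})` and
`|∂ₖw| ≤ A³δ⁻³ 𝟙 (…) (𝟙_{‖xₖ‖≤2δ} + 𝟙_{‖xₖ-½‖≤2δ})`, and a smooth exactly mirror-symmetric field `v`,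
the three pairings `∫ w vⱼ ∂ⱼvₖ` (`j = k, l, 2`) are bounded by `14 A³ δ⁻¹ ∫_N ∑ⱼ ‖∂ⱼv‖²`, granted the
slab Poincaré inequality for odd functions (hypothesis). [folklore] -/
theorem tube_component_bound
    (hP : ∀ (i : Fin 3) (a : ℝ) (u φ : UnitAddTorus (Fin 3) → ℝ), 0 < a → a ≤ 4⁻¹ → Torus.IsSmooth u →
      (∀ x, u (Function.update x i (-x i)) = -u x) → Measurable φ → (∀ x, 0 ≤ φ x) →
      (∃ B : ℝ, ∀ x, φ x ≤ B) →
      (∀ (x : UnitAddTorus (Fin 3)) (t : UnitAddCircle), φ (Function.update x i t) = φ x) →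
      (∫ x in {x : UnitAddTorus (Fin 3) | ‖x i‖ ≤ a}, φ x * u x ^ 2 ≤
          a ^ 2 * ∫ x in {x : UnitAddTorus (Fin 3) | ‖x i‖ ≤ a}, φ x * Torus.partialDeriv i u x ^ 2) ∧
      (∫ x in {x : UnitAddTorus (Fin 3) | ‖x i - ((2⁻¹ : ℝ) : UnitAddCircle)‖ ≤ a}, φ x * u x ^ 2 ≤
          a ^ 2 * ∫ x in {x : UnitAddTorus (Fin 3) | ‖x i - ((2⁻¹ : ℝ) : UnitAddCircle)‖ ≤ a},
            φ x * Torus.partialDeriv i u x ^ 2))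
    {A δ : ℝ} (hA : 1 ≤ A) (hδ : 0 < δ) (hδ16 : δ ≤ 16⁻¹)
    {v : UnitAddTorus (Fin 3) → EuclideanSpace ℝ (Fin 3)} (hv : Torus.IsSmooth v)
    (hK : ∀ (i j : Fin 3) (x : UnitAddTorus (Fin 3)),
      v (Function.update x i (-x i)) j = if j = i then -(v x j) else v x j)
    {k l : Fin 3} (hkl : k ≠ l) (hk2 : k ≠ 2) (hl2 : l ≠ 2)
    {w : UnitAddTorus (Fin 3) → ℝ} (hw : Torus.IsSmooth w)
    {N : Set (UnitAddTorus (Fin 3))} (hN : MeasurableSet N)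
    (hNl : ∀ x : UnitAddTorus (Fin 3), ‖x 2‖ ≤ δ →
      (‖x l‖ ≤ 2 * δ ∨ ‖x l - ((2⁻¹ : ℝ) : UnitAddCircle)‖ ≤ 2 * δ) → x ∈ N)
    (hwb : ∀ x, |w x| ≤ A ^ 2 / δ ^ 2 * ({y : UnitAddTorus (Fin 3) | ‖y 2‖ ≤ δ}.indicator 1 x *
      ({y : UnitAddTorus (Fin 3) | ‖y l‖ ≤ 2 * δ}.indicator 1 x +
        {y : UnitAddTorus (Fin 3) | ‖y l - ((2⁻¹ : ℝ) : UnitAddCircle)‖ ≤ 2 * δ}.indicator 1 x)))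
    (hdwb : ∀ x, |Torus.partialDeriv k w x| ≤ A ^ 3 / δ ^ 3 *
      ({y : UnitAddTorus (Fin 3) | ‖y 2‖ ≤ δ}.indicator 1 x *
        ({y : UnitAddTorus (Fin 3) | ‖y l‖ ≤ 2 * δ}.indicator 1 x +
          {y : UnitAddTorus (Fin 3) | ‖y l - ((2⁻¹ : ℝ) : UnitAddCircle)‖ ≤ 2 * δ}.indicator 1 x) *
        ({y : UnitAddTorus (Fin 3) | ‖y k‖ ≤ 2 * δ}.indicator 1 x +
          {y : UnitAddTorus (Fin 3) | ‖y k - ((2⁻¹ : ℝ) : UnitAddCircle)‖ ≤ 2 * δ}.indicator 1 x))) :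
    |∫ x, w x * (v x k * Torus.partialDeriv k (fun y => v y k) x)| +
      |∫ x, w x * (v x l * Torus.partialDeriv l (fun y => v y k) x)| +
      |∫ x, w x * (v x 2 * Torus.partialDeriv 2 (fun y => v y k) x)| ≤
      14 * A ^ 3 / δ * ∫ x in N, ∑ j, ‖Torus.partialDeriv j v x‖ ^ 2 := by
  -- the slabs
  set S2 : Set (UnitAddTorus (Fin 3)) := {y | ‖y 2‖ ≤ δ} with hS2
  set Sl : Set (UnitAddTorus (Fin 3)) := {y | ‖y l‖ ≤ 2 * δ} with hSl
  set Sl' : Set (UnitAddTorus (Fin 3)) := {y | ‖y l - ((2⁻¹ : ℝ) : UnitAddCircle)‖ ≤ 2 * δ} with hSl'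
  set Sk : Set (UnitAddTorus (Fin 3)) := {y | ‖y k‖ ≤ 2 * δ} with hSk
  set Sk' : Set (UnitAddTorus (Fin 3)) := {y | ‖y k - ((2⁻¹ : ℝ) : UnitAddCircle)‖ ≤ 2 * δ} with hSk'
  have mS2 : MeasurableSet S2 := tube_measurableSet_slab_zero 2 δ
  have mSl : MeasurableSet Sl := tube_measurableSet_slab_zero l (2 * δ)
  have mSl' : MeasurableSet Sl' := tube_measurableSet_slab l _ (2 * δ)
  have mSk : MeasurableSet Sk := tube_measurableSet_slab_zero k (2 * δ)
  have mSk' : MeasurableSet Sk' := tube_measurableSet_slab k _ (2 * δ)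
  have h2δ : 0 < 2 * δ := by positivity
  have h2δ4 : 2 * δ ≤ 4⁻¹ := by linarith
  have hδ4 : δ ≤ 4⁻¹ := by linarith
  have hA0 : 0 ≤ A := by linarith
  have hM2 : 0 ≤ A ^ 2 / δ ^ 2 := by positivity
  have hM3 : 0 ≤ A ^ 3 / δ ^ 3 := by positivity
  have hodd : ∀ i : Fin 3, ∀ x, (fun y => v y i) (Function.update x i (-x i)) = -(fun y => v y i) x :=
    fun i x => by simp [hK i i x]
  have mφ2 : Measurable fun x => S2.indicator (1 : UnitAddTorus (Fin 3) → ℝ) x :=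
    measurable_one.indicator mS2
  have mχl : Measurable fun x => Sl.indicator (1 : UnitAddTorus (Fin 3) → ℝ) x + Sl'.indicator 1 x :=
    (measurable_one.indicator mSl).add (measurable_one.indicator mSl')
  have mχk : Measurable fun x => Sk.indicator (1 : UnitAddTorus (Fin 3) → ℝ) x + Sk'.indicator 1 x :=
    (measurable_one.indicator mSk).add (measurable_one.indicator mSk')
  have inv2 : ∀ (i : Fin 3), i ≠ 2 → ∀ (x : UnitAddTorus (Fin 3)) (t : UnitAddCircle),
      S2.indicator (1 : UnitAddTorus (Fin 3) → ℝ) (Function.update x i t) = S2.indicator 1 x := by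
    intro i hi x t
    simp only [hS2, Set.indicator_apply, Set.mem_setOf_eq, Function.update_of_ne hi.symm, Pi.one_apply]
  have invl : ∀ (i : Fin 3), i ≠ l → ∀ (x : UnitAddTorus (Fin 3)) (t : UnitAddCircle),
      Sl.indicator (1 : UnitAddTorus (Fin 3) → ℝ) (Function.update x i t) + Sl'.indicator 1 (Function.update x i t) =
        Sl.indicator 1 x + Sl'.indicator 1 x := by
    intro i hi x t
    simp only [hSl, hSl', Set.indicator_apply, Set.mem_setOf_eq, Function.update_of_ne hi.symm, Pi.one_apply]
  -- (1) Poincaré in direction `l`, weight `𝟙_{S2}`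
  obtain ⟨Pl, Pl'⟩ := hP l (2 * δ) (fun y => v y l) (fun x => S2.indicator 1 x) h2δ h2δ4 (hv.apply l)
    (hodd l) mφ2 (fun x => tube_indicator_nonneg S2 x) ⟨1, fun x => tube_indicator_le_one S2 x⟩
    (fun x t => inv2 l hl2 x t)
  have P1 := tube_poincare_two_slabs (C := 1) mSl mSl' mφ2 (fun x => tube_indicator_nonneg S2 x)
    (fun x => tube_indicator_le_one S2 x) (hv.apply l).continuous ((hv.apply l).partialDeriv l).continuous
    Pl Pl'
  -- (2) Poincaré in direction `2`, weight `𝟙_{Sl} + 𝟙_{Sl'}`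
  obtain ⟨P2, -⟩ := hP 2 δ (fun y => v y 2) (fun x => Sl.indicator 1 x + Sl'.indicator 1 x) hδ hδ4
    (hv.apply 2) (hodd 2) mχl (fun x => add_nonneg (tube_indicator_nonneg Sl x) (tube_indicator_nonneg Sl' x))
    ⟨2, fun x => by linarith [tube_indicator_le_one Sl x, tube_indicator_le_one Sl' x]⟩
    (fun x t => invl 2 hl2.symm x t)
  have P2' := tube_poincare_slab mS2 P2
  -- (3) Poincaré in direction `k`, weight `𝟙_{S2} (𝟙_{Sl} + 𝟙_{Sl'})`
  have mψ : Measurable fun x => S2.indicator (1 : UnitAddTorus (Fin 3) → ℝ) x *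
      (Sl.indicator 1 x + Sl'.indicator 1 x) := mφ2.mul mχl
  have ψnn : ∀ x, 0 ≤ S2.indicator (1 : UnitAddTorus (Fin 3) → ℝ) x * (Sl.indicator 1 x + Sl'.indicator 1 x) :=
    fun x => mul_nonneg (tube_indicator_nonneg S2 x)
      (add_nonneg (tube_indicator_nonneg Sl x) (tube_indicator_nonneg Sl' x))
  have ψle : ∀ x, S2.indicator (1 : UnitAddTorus (Fin 3) → ℝ) x * (Sl.indicator 1 x + Sl'.indicator 1 x) ≤ 2 :=
    fun x => by
      have := tube_indicator_le_one S2 x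
      have := tube_indicator_le_one Sl x
      have := tube_indicator_le_one Sl' x
      have := tube_indicator_nonneg S2 x
      nlinarith [tube_indicator_nonneg Sl x, tube_indicator_nonneg Sl' x]
  obtain ⟨Pk, Pk'⟩ := hP k (2 * δ) (fun y => v y k)
    (fun x => S2.indicator 1 x * (Sl.indicator 1 x + Sl'.indicator 1 x)) h2δ h2δ4 (hv.apply k) (hodd k) mψ
    ψnn ⟨2, ψle⟩ (fun x t => by rw [inv2 k hk2 x t, invl k hkl x t])
  have P3 := tube_poincare_two_slabs (C := 2) mSk mSk' mψ ψnn ψle (hv.apply k).continuous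
    ((hv.apply k).partialDeriv k).continuous Pk Pk'
  have T1 := tube_transversal_abstract (C := 2) (M := A ^ 2 / δ ^ 2) (w := w)
    (ψ := fun x => S2.indicator (1 : UnitAddTorus (Fin 3) → ℝ) x * (Sl.indicator 1 x + Sl'.indicator 1 x))
    (p := fun x => Torus.partialDeriv l (fun y => v y k) x) h2δ hM2 mψ ψnn ψle (hv.apply l).continuous
    ((hv.apply k).partialDeriv l).continuous hwb P1
  have mψ' : Measurable fun x => (Sl.indicator (1 : UnitAddTorus (Fin 3) → ℝ) x + Sl'.indicator 1 x) *
      S2.indicator 1 x := mχl.mul mφ2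
  have ψ'nn : ∀ x, 0 ≤ (Sl.indicator (1 : UnitAddTorus (Fin 3) → ℝ) x + Sl'.indicator 1 x) * S2.indicator 1 x :=
    fun x => by rw [mul_comm]; exact ψnn x
  have ψ'le : ∀ x, (Sl.indicator (1 : UnitAddTorus (Fin 3) → ℝ) x + Sl'.indicator 1 x) * S2.indicator 1 x ≤ 2 :=
    fun x => by rw [mul_comm]; exact ψle x
  have T2 := tube_transversal_abstract (C := 2) (M := A ^ 2 / δ ^ 2) (w := w)
    (ψ := fun x => (Sl.indicator (1 : UnitAddTorus (Fin 3) → ℝ) x + Sl'.indicator 1 x) * S2.indicator 1 x)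
    (p := fun x => Torus.partialDeriv 2 (fun y => v y k) x) hδ hM2 mψ' ψ'nn ψ'le (hv.apply 2).continuous
    ((hv.apply k).partialDeriv 2).continuous (fun x => by rw [mul_comm (_ + _)]; exact hwb x) P2'
  have mψk : Measurable fun x => S2.indicator (1 : UnitAddTorus (Fin 3) → ℝ) x *
      (Sl.indicator 1 x + Sl'.indicator 1 x) * (Sk.indicator 1 x + Sk'.indicator 1 x) := mψ.mul mχk
  have ψknn : ∀ x, 0 ≤ S2.indicator (1 : UnitAddTorus (Fin 3) → ℝ) x *
      (Sl.indicator 1 x + Sl'.indicator 1 x) * (Sk.indicator 1 x + Sk'.indicator 1 x) :=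
    fun x => mul_nonneg (ψnn x) (add_nonneg (tube_indicator_nonneg Sk x) (tube_indicator_nonneg Sk' x))
  have ψkle : ∀ x, S2.indicator (1 : UnitAddTorus (Fin 3) → ℝ) x *
      (Sl.indicator 1 x + Sl'.indicator 1 x) * (Sk.indicator 1 x + Sk'.indicator 1 x) ≤ 4 :=
    fun x => by
      have := tube_indicator_le_one Sk x
      have := tube_indicator_le_one Sk' x
      nlinarith [ψnn x, ψle x, tube_indicator_nonneg Sk x, tube_indicator_nonneg Sk' x]
  have T3 := tube_longitudinal_abstract k (C := 4) (M := A ^ 3 / δ ^ 3) hM3 mψk ψknn ψkle hw (hv.apply k)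
    hdwb P3
  set F : UnitAddTorus (Fin 3) → ℝ := fun x => ∑ j, ‖Torus.partialDeriv j v x‖ ^ 2 with hF
  have hFc : Continuous F := continuous_finsetSum _ fun j _ => ((hv.partialDeriv j).continuous.norm).pow 2
  have hF0 : ∀ x, 0 ≤ F x := fun x => Finset.sum_nonneg fun j _ => sq_nonneg _
  have hψN : ∀ x, S2.indicator (1 : UnitAddTorus (Fin 3) → ℝ) x * (Sl.indicator 1 x + Sl'.indicator 1 x) ≤
      2 * N.indicator 1 x := by
    intro x
    by_cases h2 : x ∈ S2
    · by_cases hl : x ∈ Sl ∪ Sl'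
      · have hxN : x ∈ N := hNl x h2 hl
        rw [Set.indicator_of_mem hxN, Pi.one_apply, mul_one]
        exact ψle x
      · rw [Set.mem_union, not_or] at hl
        rw [Set.indicator_of_notMem hl.1, Set.indicator_of_notMem hl.2, add_zero, mul_zero]
        exact mul_nonneg zero_le_two (tube_indicator_nonneg N x)
    · rw [Set.indicator_of_notMem h2, zero_mul]
      exact mul_nonneg zero_le_two (tube_indicator_nonneg N x)
  have hψ'N : ∀ x, (Sl.indicator (1 : UnitAddTorus (Fin 3) → ℝ) x + Sl'.indicator 1 x) * S2.indicator 1 x ≤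
      2 * N.indicator 1 x := fun x => by rw [mul_comm]; exact hψN x
  have hψkN : ∀ x, S2.indicator (1 : UnitAddTorus (Fin 3) → ℝ) x * (Sl.indicator 1 x + Sl'.indicator 1 x) *
      (Sk.indicator 1 x + Sk'.indicator 1 x) ≤ 4 * N.indicator 1 x := by
    intro x
    have h := hψN x
    have := tube_indicator_le_one Sk x
    have := tube_indicator_le_one Sk' x
    nlinarith [ψnn x, tube_indicator_nonneg Sk x, tube_indicator_nonneg Sk' x, tube_indicator_nonneg N x]
  have B1 := tube_integral_weight_mul_le hN hFc (fun x => sq_nonneg _)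
    (fun x => tube_sq_partialDeriv_apply_le hv l l x) ψnn hψN
  have B2 := tube_integral_weight_mul_le hN hFc (fun x => sq_nonneg _)
    (fun x => tube_sq_partialDeriv_apply_le hv l k x) ψnn hψN
  have B3 := tube_integral_weight_mul_le hN hFc (fun x => sq_nonneg _)
    (fun x => tube_sq_partialDeriv_apply_le hv 2 2 x) ψ'nn hψ'N
  have B4 := tube_integral_weight_mul_le hN hFc (fun x => sq_nonneg _)
    (fun x => tube_sq_partialDeriv_apply_le hv 2 k x) ψ'nn hψ'N
  have B5 := tube_integral_weight_mul_le hN hFc (fun x => sq_nonneg _)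
    (fun x => tube_sq_partialDeriv_apply_le hv k k x) ψknn hψkN
  have hX : 0 ≤ ∫ x in N, F x := setIntegral_nonneg hN fun x _ => hF0 x
  have hA23 : A ^ 2 / δ ≤ A ^ 3 / δ := div_le_div_of_nonneg_right (by nlinarith) hδ.le
  have hδ0 : δ ≠ 0 := hδ.ne'
  have E1 : |∫ x, w x * (v x l * Torus.partialDeriv l (fun y => v y k) x)| ≤ 4 * (A ^ 2 / δ) * ∫ x in N, F x :=
    T1.trans <| by
      calc A ^ 2 / δ ^ 2 * (2 * δ) / 2 * ((∫ x, S2.indicator (1 : UnitAddTorus (Fin 3) → ℝ) x *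
              (Sl.indicator 1 x + Sl'.indicator 1 x) * Torus.partialDeriv l (fun y => v y l) x ^ 2) +
              ∫ x, S2.indicator (1 : UnitAddTorus (Fin 3) → ℝ) x * (Sl.indicator 1 x + Sl'.indicator 1 x) *
                Torus.partialDeriv l (fun y => v y k) x ^ 2)
          ≤ A ^ 2 / δ ^ 2 * (2 * δ) / 2 * (2 * (∫ x in N, F x) + 2 * ∫ x in N, F x) := by gcongr
        _ = 4 * (A ^ 2 / δ) * ∫ x in N, F x := by field_simp; ring
  have E2 : |∫ x, w x * (v x 2 * Torus.partialDeriv 2 (fun y => v y k) x)| ≤ 2 * (A ^ 2 / δ) * ∫ x in N, F x :=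
    T2.trans <| by
      calc A ^ 2 / δ ^ 2 * δ / 2 * ((∫ x, (Sl.indicator (1 : UnitAddTorus (Fin 3) → ℝ) x + Sl'.indicator 1 x) *
              S2.indicator 1 x * Torus.partialDeriv 2 (fun y => v y 2) x ^ 2) +
              ∫ x, (Sl.indicator (1 : UnitAddTorus (Fin 3) → ℝ) x + Sl'.indicator 1 x) * S2.indicator 1 x *
                Torus.partialDeriv 2 (fun y => v y k) x ^ 2)
          ≤ A ^ 2 / δ ^ 2 * δ / 2 * (2 * (∫ x in N, F x) + 2 * ∫ x in N, F x) := by gcongr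
        _ = 2 * (A ^ 2 / δ) * ∫ x in N, F x := by field_simp; ring
  have E3 : |∫ x, w x * (v x k * Torus.partialDeriv k (fun y => v y k) x)| ≤ 8 * (A ^ 3 / δ) * ∫ x in N, F x :=
    T3.trans <| by
      calc A ^ 3 / δ ^ 3 / 2 * (2 * δ) ^ 2 * ∫ x, S2.indicator (1 : UnitAddTorus (Fin 3) → ℝ) x *
              (Sl.indicator 1 x + Sl'.indicator 1 x) * (Sk.indicator 1 x + Sk'.indicator 1 x) *
              Torus.partialDeriv k (fun y => v y k) x ^ 2
          ≤ A ^ 3 / δ ^ 3 / 2 * (2 * δ) ^ 2 * (4 * ∫ x in N, F x) := by gcongr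
        _ = 8 * (A ^ 3 / δ) * ∫ x in N, F x := by field_simp; ring
  calc |∫ x, w x * (v x k * Torus.partialDeriv k (fun y => v y k) x)| +
        |∫ x, w x * (v x l * Torus.partialDeriv l (fun y => v y k) x)| +
        |∫ x, w x * (v x 2 * Torus.partialDeriv 2 (fun y => v y k) x)|
      ≤ 8 * (A ^ 3 / δ) * (∫ x in N, F x) + 4 * (A ^ 2 / δ) * (∫ x in N, F x) +
          2 * (A ^ 2 / δ) * ∫ x in N, F x := add_le_add (add_le_add E3 E1) E2
    _ ≤ 8 * (A ^ 3 / δ) * (∫ x in N, F x) + 4 * (A ^ 3 / δ) * (∫ x in N, F x) +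
          2 * (A ^ 3 / δ) * ∫ x in N, F x := by
        have h4 : 4 * (A ^ 2 / δ) * (∫ x in N, F x) ≤ 4 * (A ^ 3 / δ) * ∫ x in N, F x :=
          mul_le_mul_of_nonneg_right (mul_le_mul_of_nonneg_left hA23 (by norm_num)) hX
        have h2 : 2 * (A ^ 2 / δ) * (∫ x in N, F x) ≤ 2 * (A ^ 3 / δ) * ∫ x in N, F x :=
          mul_le_mul_of_nonneg_right (mul_le_mul_of_nonneg_left hA23 (by norm_num)) hX
        linarith
    _ = 14 * A ^ 3 / δ * ∫ x in N, F x := by ring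

/-! ## The tube law -/

/-- **T2b `stub_tubeLawSmoothK`** — the deterministic KELVIN TUBE INEQUALITY for smooth fields. Granted the
slab Poincaré inequality for smooth functions odd under `xᵢ ↦ -xᵢ` (stub T2a, the hypothesis), there is an
absolute `K` (`K = 28`) such that for all tube profiles `ρ, η` of amplitude `A/δ` and width `δ ≤ 1/16` and every
smooth divergence-free mean-zero field `v` on `T³` exactly symmetric under the three mirrors
(`v_j(R_i x) = ∓ v_j(x)`), the pairing of `v ⊗ v` with the gradient of the tube current
`g = (η(x₂)ρ(x₀)ρ'(x₁), -η(x₂)ρ'(x₀)ρ(x₁), 0)` of the skeleton loop `C = ∂([0,½]² × {x₂ = 0})` obeys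
`|∫ ⟪Dg[v], v⟫| ≤ K A³ δ⁻¹ ∫_{N_δ} ∑ⱼ ‖∂ⱼv‖²`, `N_δ` the `δ`-neighbourhood of the four edges inside the slab
`‖x₂‖ ≤ δ` (integration by parts against the solenoidal field, Young, odd Poincaré across the mirror planes;
TG mirror symmetries: Brachet et al., J. Fluid Mech. 130 (1983), §2). [folklore] -/
theorem stub_tubeLawSmoothK :
    (∀ (i : Fin 3) (a : ℝ) (u φ : UnitAddTorus (Fin 3) → ℝ), 0 < a → a ≤ 4⁻¹ → Torus.IsSmooth u →
      (∀ x, u (Function.update x i (-x i)) = -u x) → Measurable φ → (∀ x, 0 ≤ φ x) →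
      (∃ B : ℝ, ∀ x, φ x ≤ B) → (∀ (x : UnitAddTorus (Fin 3)) (t : UnitAddCircle), φ (Function.update x i t) = φ x) →
      (∫ x in {x : UnitAddTorus (Fin 3) | ‖x i‖ ≤ a}, φ x * u x ^ 2 ≤
          a ^ 2 * ∫ x in {x : UnitAddTorus (Fin 3) | ‖x i‖ ≤ a}, φ x * Torus.partialDeriv i u x ^ 2) ∧
      (∫ x in {x : UnitAddTorus (Fin 3) | ‖x i - ((2⁻¹ : ℝ) : UnitAddCircle)‖ ≤ a}, φ x * u x ^ 2 ≤
          a ^ 2 * ∫ x in {x : UnitAddTorus (Fin 3) | ‖x i - ((2⁻¹ : ℝ) : UnitAddCircle)‖ ≤ a},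
            φ x * Torus.partialDeriv i u x ^ 2)) →
    ∃ K : ℝ, 0 < K ∧ ∀ (A δ : ℝ) (ρ η : ℝ → ℝ), 1 ≤ A → 0 < δ → δ ≤ 16⁻¹ →
      ContDiff ℝ (⊤ : ℕ∞) ρ → ContDiff ℝ (⊤ : ℕ∞) η → Function.Periodic ρ 1 → Function.Periodic η 1 →
      (∀ t, |η t| ≤ A / δ) → (∀ t, |ρ t| ≤ 1) → (∀ t, |deriv ρ t| ≤ A / δ) →
      (∀ t, δ ≤ t → t ≤ 1 - δ → η t = 0) →
      (∀ t, 0 ≤ t → t ≤ 1 → deriv ρ t ≠ 0 → (δ < t ∧ t < 2 * δ) ∨ (2⁻¹ - 2 * δ < t ∧ t < 2⁻¹ - δ)) →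
      ∀ v : UnitAddTorus (Fin 3) → EuclideanSpace ℝ (Fin 3), Torus.IsSmooth v → Torus.IsDivFree v →
        Torus.HasZeroMean v →
        (∀ (i j : Fin 3) (x : UnitAddTorus (Fin 3)), v (Function.update x i (-x i)) j = if j = i then -(v x j) else v x j) →
        |∫ x, ⟪Torus.fderiv (fun y : UnitAddTorus (Fin 3) =>
            !₂[η (Torus.repr y 2) * ρ (Torus.repr y 0) * deriv ρ (Torus.repr y 1),
               -(η (Torus.repr y 2) * deriv ρ (Torus.repr y 0) * ρ (Torus.repr y 1)), (0 : ℝ)]) x (v x), v x⟫_ℝ| ≤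
          K * A ^ 3 / δ * ∫ x in {x : UnitAddTorus (Fin 3) | ‖x 2‖ ≤ δ ∧ (‖x 0‖ ≤ 2 * δ ∨
              ‖x 0 - ((2⁻¹ : ℝ) : UnitAddCircle)‖ ≤ 2 * δ ∨ ‖x 1‖ ≤ 2 * δ ∨ ‖x 1 - ((2⁻¹ : ℝ) : UnitAddCircle)‖ ≤ 2 * δ)},
            ∑ j, ‖Torus.partialDeriv j v x‖ ^ 2 := by
  intro hP
  refine ⟨28, by norm_num, ?_⟩
  intro A δ ρ η hA hδ hδ16 hρ hη hpρ hpη hηb hρb hdρb hη0 hdρ0 v hv hdiv _ hK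
  have hAδ : 0 ≤ A / δ := div_nonneg (by linarith) hδ.le
  have hdρ : ContDiff ℝ (⊤ : ℕ∞) (deriv ρ) := (contDiff_infty_iff_deriv.1 hρ).2
  have hpdρ : Function.Periodic (deriv ρ) 1 := hpρ.deriv
  have hndρ : ContDiff ℝ (⊤ : ℕ∞) (fun t => -deriv ρ t) := hdρ.neg
  have hpndρ : Function.Periodic (fun t => -deriv ρ t) 1 := fun t => by
    show -deriv ρ (t + 1) = -deriv ρ t
    rw [hpdρ t]
  -- the current and its components
  have hg := tube_isSmooth_current hρ hη hpρ hpη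
  set g : UnitAddTorus (Fin 3) → EuclideanSpace ℝ (Fin 3) := fun y =>
    !₂[η (Torus.repr y 2) * ρ (Torus.repr y 0) * deriv ρ (Torus.repr y 1),
      -(η (Torus.repr y 2) * deriv ρ (Torus.repr y 0) * ρ (Torus.repr y 1)), (0 : ℝ)] with hg_def
  have hg0 : (fun x => g x 0) = fun x =>
      η (Torus.repr x 2) * ρ (Torus.repr x 0) * deriv ρ (Torus.repr x 1) := by
    funext x; simp [hg_def]
  have hg1 : (fun x => g x 1) = fun x =>
      η (Torus.repr x 2) * (-deriv ρ (Torus.repr x 0)) * ρ (Torus.repr x 1) := by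
    funext x; simp [hg_def]
  have hg2 : ∀ x, g x 2 = 0 := fun x => by simp [hg_def]
  have hw0 : Torus.IsSmooth (fun x => g x 0) := by
    rw [hg0]; exact tube_isSmooth_profile hρ hdρ hη hpρ hpdρ hpη
  have hw1 : Torus.IsSmooth (fun x => g x 1) := by
    rw [hg1]; exact tube_isSmooth_profile hndρ hρ hη hpndρ hpρ hpη
  -- Step 1: integration by parts against the solenoidal field and expansion in components
  rw [tube_integral_inner_fderiv_eq_neg hg hv hdiv, abs_neg]
  have hS : ∀ x, ⟪g x, Torus.fderiv v x (v x)⟫_ℝ =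
      (g x 0 * (v x 0 * Torus.partialDeriv 0 (fun y => v y 0) x) +
        g x 0 * (v x 1 * Torus.partialDeriv 1 (fun y => v y 0) x) +
        g x 0 * (v x 2 * Torus.partialDeriv 2 (fun y => v y 0) x)) +
      (g x 1 * (v x 0 * Torus.partialDeriv 0 (fun y => v y 1) x) +
        g x 1 * (v x 1 * Torus.partialDeriv 1 (fun y => v y 1) x) +
        g x 1 * (v x 2 * Torus.partialDeriv 2 (fun y => v y 1) x)) := by
    intro x
    rw [tube_inner_fderiv_apply_eq_sum hv, Fin.sum_univ_three, hg2, zero_mul, add_zero,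
      Fin.sum_univ_three, Fin.sum_univ_three]
    ring
  simp_rw [hS]
  have hc : ∀ m n j : Fin 3,
      Continuous (fun x => g x m * (v x j * Torus.partialDeriv j (fun y => v y n) x)) :=
    fun m n j => (hg.apply m).continuous.mul
      ((hv.apply j).continuous.mul ((hv.apply n).partialDeriv j).continuous)
  have hi := fun m n j => (hc m n j).integrable_unitAddTorus
  rw [integral_add (((hi 0 0 0).fun_add (hi 0 0 1)).fun_add (hi 0 0 2))
      (((hi 1 1 0).fun_add (hi 1 1 1)).fun_add (hi 1 1 2)),
    integral_add ((hi 0 0 0).fun_add (hi 0 0 1)) (hi 0 0 2), integral_add (hi 0 0 0) (hi 0 0 1),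
    integral_add ((hi 1 1 0).fun_add (hi 1 1 1)) (hi 1 1 2), integral_add (hi 1 1 0) (hi 1 1 1)]
  -- Step 2: the slab bookkeeping
  have mS2 := tube_measurableSet_slab_zero 2 δ
  have mS0 := tube_measurableSet_slab_zero 0 (2 * δ)
  have mS0' := tube_measurableSet_slab 0 ((2⁻¹ : ℝ) : UnitAddCircle) (2 * δ)
  have mS1 := tube_measurableSet_slab_zero 1 (2 * δ)
  have mS1' := tube_measurableSet_slab 1 ((2⁻¹ : ℝ) : UnitAddCircle) (2 * δ)
  have hN : MeasurableSet {x : UnitAddTorus (Fin 3) | ‖x 2‖ ≤ δ ∧ (‖x 0‖ ≤ 2 * δ ∨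
      ‖x 0 - ((2⁻¹ : ℝ) : UnitAddCircle)‖ ≤ 2 * δ ∨ ‖x 1‖ ≤ 2 * δ ∨
      ‖x 1 - ((2⁻¹ : ℝ) : UnitAddCircle)‖ ≤ 2 * δ)} :=
    mS2.inter (mS0.union (mS0'.union (mS1.union mS1')))
  -- Step 3: pointwise bounds on the weights and their longitudinal derivatives
  have hwb0 : ∀ x, |(fun x => g x 0) x| ≤ A ^ 2 / δ ^ 2 *
      ({y : UnitAddTorus (Fin 3) | ‖y 2‖ ≤ δ}.indicator 1 x *
        ({y : UnitAddTorus (Fin 3) | ‖y 1‖ ≤ 2 * δ}.indicator 1 x +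
          {y : UnitAddTorus (Fin 3) | ‖y 1 - ((2⁻¹ : ℝ) : UnitAddCircle)‖ ≤ 2 * δ}.indicator 1 x)) := by
    intro x
    rw [hg0, abs_mul, abs_mul]
    exact tube_weight_bound hAδ hηb hη0 hdρb hdρ0 (hρb _) 1 x
  have hwb1 : ∀ x, |(fun x => g x 1) x| ≤ A ^ 2 / δ ^ 2 *
      ({y : UnitAddTorus (Fin 3) | ‖y 2‖ ≤ δ}.indicator 1 x *
        ({y : UnitAddTorus (Fin 3) | ‖y 0‖ ≤ 2 * δ}.indicator 1 x +
          {y : UnitAddTorus (Fin 3) | ‖y 0 - ((2⁻¹ : ℝ) : UnitAddCircle)‖ ≤ 2 * δ}.indicator 1 x)) := by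
    intro x
    rw [hg1, abs_mul, abs_mul, abs_neg, mul_right_comm]
    exact tube_weight_bound hAδ hηb hη0 hdρb hdρ0 (hρb _) 0 x
  have hdwb0 : ∀ x, |Torus.partialDeriv 0 (fun x => g x 0) x| ≤ A ^ 3 / δ ^ 3 *
      ({y : UnitAddTorus (Fin 3) | ‖y 2‖ ≤ δ}.indicator 1 x *
        ({y : UnitAddTorus (Fin 3) | ‖y 1‖ ≤ 2 * δ}.indicator 1 x +
          {y : UnitAddTorus (Fin 3) | ‖y 1 - ((2⁻¹ : ℝ) : UnitAddCircle)‖ ≤ 2 * δ}.indicator 1 x) *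
        ({y : UnitAddTorus (Fin 3) | ‖y 0‖ ≤ 2 * δ}.indicator 1 x +
          {y : UnitAddTorus (Fin 3) | ‖y 0 - ((2⁻¹ : ℝ) : UnitAddCircle)‖ ≤ 2 * δ}.indicator 1 x)) := by
    intro x
    rw [hg0, tube_partialDeriv_zero_profile hρ hpρ hpdρ hpη x, abs_mul, abs_mul]
    exact tube_dweight_bound hAδ hηb hη0 hdρb hdρ0 0 1 x
  have hdwb1 : ∀ x, |Torus.partialDeriv 1 (fun x => g x 1) x| ≤ A ^ 3 / δ ^ 3 *
      ({y : UnitAddTorus (Fin 3) | ‖y 2‖ ≤ δ}.indicator 1 x *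
        ({y : UnitAddTorus (Fin 3) | ‖y 0‖ ≤ 2 * δ}.indicator 1 x +
          {y : UnitAddTorus (Fin 3) | ‖y 0 - ((2⁻¹ : ℝ) : UnitAddCircle)‖ ≤ 2 * δ}.indicator 1 x) *
        ({y : UnitAddTorus (Fin 3) | ‖y 1‖ ≤ 2 * δ}.indicator 1 x +
          {y : UnitAddTorus (Fin 3) | ‖y 1 - ((2⁻¹ : ℝ) : UnitAddCircle)‖ ≤ 2 * δ}.indicator 1 x)) := by
    intro x
    rw [hg1, tube_partialDeriv_one_profile hρ hpndρ hpρ hpη x, abs_mul, abs_mul, abs_neg,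
      mul_right_comm]
    exact tube_dweight_bound hAδ hηb hη0 hdρb hdρ0 1 0 x
  -- Step 4: the two component bounds
  have K0 := tube_component_bound hP hA hδ hδ16 hv hK (k := 0) (l := 1) (by decide) (by decide) (by decide)
    hw0 hN (fun x h2 h => ⟨h2, Or.inr (Or.inr h)⟩) hwb0 hdwb0
  have K1 := tube_component_bound hP hA hδ hδ16 hv hK (k := 1) (l := 0) (by decide) (by decide) (by decide)
    hw1 hN (fun x h2 h => ⟨h2, h.elim Or.inl fun h' => Or.inr (Or.inl h')⟩) hwb1 hdwb1
  have hX : 0 ≤ ∫ x in {x : UnitAddTorus (Fin 3) | ‖x 2‖ ≤ δ ∧ (‖x 0‖ ≤ 2 * δ ∨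
      ‖x 0 - ((2⁻¹ : ℝ) : UnitAddCircle)‖ ≤ 2 * δ ∨ ‖x 1‖ ≤ 2 * δ ∨
      ‖x 1 - ((2⁻¹ : ℝ) : UnitAddCircle)‖ ≤ 2 * δ)}, ∑ j, ‖Torus.partialDeriv j v x‖ ^ 2 :=
    setIntegral_nonneg hN fun x _ => Finset.sum_nonneg fun j _ => sq_nonneg _
  have tri : ∀ a b c d e f : ℝ, |a + b + c + (d + e + f)| ≤ |a| + |b| + |c| + (|d| + |e| + |f|) := by
    intro a b c d e f
    refine (abs_add_le _ _).trans (add_le_add ?_ ?_) <;>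
      exact (abs_add_le _ _).trans (add_le_add_left (abs_add_le _ _) _)
  refine (tri _ _ _ _ _ _).trans ?_
  rw [add_comm |∫ x, g x 1 * (v x 0 * Torus.partialDeriv 0 (fun y => v y 1) x)|]
  refine (add_le_add K0 K1).trans (le_of_eq ?_)
  ring

end Summit.AnomalousDissipation.AnomalousDissipation.Theorems.MirrorEnsembleMirrorStatisticsLoudTG

end
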